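import Mathlib.Analysis.SpecialFunctions.Log.Deriv
import Mathlib.Analysis.SpecialFunctions.Log.NegMulLog
import Mathlib.Analysis.Complex.ExponentialBounds
import Mathlib.Analysis.Calculus.Deriv.MeanValue
import Literature.NumberTheory.LFunctions.BookerLemmaIntegral
import HarnessLib

/-!
# Booker's lemma (Trudgian 2011, Lemma 2.10) — proof, part 2: the boundary inequalities

With `H = 𝓕 − log 4 · g` (see `BookerLemmaIntegral.lean`), the heart of Booker's argument is the
maximum principle for `Re H` on a rectangle in the upper half plane; here we establish the three
boundary estimates, for the half-strip `|Re z| ≤ 1` (Booker uses `|Re z| ≤ ½`; after the scaling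
`z = w/d` of Trudgian's version one needs `|Re z| ≤ 1/(2d) < 1`):

* bottom edge (real axis): `Re H(u) ≤ 0` for `|u| < 1` — "calculus": `E(u) ≤ E(0) = 4 log 2`
  by monotonicity, and `Re g(u) = 2/(1−u²) ≥ 2` (`bookerH_ofReal_re_nonpos`);
* vertical sides: `Re H(±1 + iv) ≤ 0` for `v > 0` (`bookerH_side_re_nonpos`).  Here Booker's
  numerical verification is replaced by an elementary argument: with `ℓ(s) = ½ log(s²+v²)`,
  `Re 𝓕(±1+iv) = ∫_0^1 (ℓ(x+2) − ℓ(x+1)) dx` and `Re g(±1+iv) = 2/(4+v²)`; the integral is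
  bounded by `2/(4+v²)` when `3v² ≥ 4` (pairing `s ↔ 4−s`), by `1/(2v)` when `1 ≤ v ≤ 6/5`, and
  by `3 log 3 − 4 log 2` when `v ≤ 1`;
* top edge: `Re H(u + iT) ≤ 5/T²` for `|u| ≤ 1`, `T > 0` (`bookerH_top_re_le`).

## References

* A. R. Booker, *Artin's conjecture, Turing's method, and the Riemann hypothesis*, Experiment.
  Math. 15 (2006), 385–407, Lemma 4.4 (proof sketch).  [Booker2006]
* T. S. Trudgian, *Improvements to Turing's method*, Math. Comp. 80 (2011), Lemma 2.10.
  [Trudgian2011]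
-/

noncomputable section

open Complex MeasureTheory intervalIntegral
open scoped ComplexConjugate

namespace Literature.NumberTheory.LFunctions

/-! ### Numerical constants -/

/-- `1.386 < log 4`. [folklore] -/
theorem real_log_four_gt : (1.386 : ℝ) < Real.log 4 := by
  rw [Real.log_four_eq]; have := Real.log_two_gt_d9; linarith

/-- `0 < log 4`. [folklore] -/
theorem real_log_four_pos : 0 < Real.log 4 := lt_trans (by norm_num) real_log_four_gt

/-! ### The bottom edge (real axis) -/

/-- `E` is even. [folklore] -/
theorem bookerE_neg (u : ℝ) : bookerE (-u) = bookerE u := by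
  simp only [bookerE]; ring_nf

/-- The derivative of `E` on `(-1, 1)`:
`E'(u) = log(2+u) − log(2−u) − 2 log(1+u) + 2 log(1−u)`. [folklore] -/
theorem hasDerivAt_bookerE {u : ℝ} (hu1 : -1 < u) (hu2 : u < 1) :
    HasDerivAt bookerE
      (Real.log (2 + u) - Real.log (2 - u) - 2 * Real.log (1 + u) + 2 * Real.log (1 - u)) u := by
  have h1 : HasDerivAt (fun u => (2 + u) * Real.log (2 + u)) (Real.log (2 + u) + 1) u :=
    HasDerivAt.comp_const_add 2 u (Real.hasDerivAt_mul_log (by linarith))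
  have h2 : HasDerivAt (fun u => (2 - u) * Real.log (2 - u)) (-(Real.log (2 - u) + 1)) u :=
    HasDerivAt.comp_const_sub 2 u (Real.hasDerivAt_mul_log (by linarith))
  have h3 : HasDerivAt (fun u => (1 + u) * Real.log (1 + u)) (Real.log (1 + u) + 1) u :=
    HasDerivAt.comp_const_add 1 u (Real.hasDerivAt_mul_log (by linarith))
  have h4 : HasDerivAt (fun u => (1 - u) * Real.log (1 - u)) (-(Real.log (1 - u) + 1)) u :=
    HasDerivAt.comp_const_sub 1 u (Real.hasDerivAt_mul_log (by linarith))
  have h := ((h1.add h2).sub (h3.const_mul 2)).sub (h4.const_mul 2)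
  have e : (Real.log (2 + u) + 1 + -(Real.log (2 - u) + 1) - 2 * (Real.log (1 + u) + 1)
      - 2 * -(Real.log (1 - u) + 1))
      = Real.log (2 + u) - Real.log (2 - u) - 2 * Real.log (1 + u) + 2 * Real.log (1 - u) := by
    ring
  rw [e] at h
  refine h.congr_of_eventuallyEq (Filter.Eventually.of_forall fun x => ?_)
  simp only [bookerE, Pi.sub_apply, Pi.add_apply]

/-- `E' ≤ 0` on `[0, 1)`: `(2+u)(1−u)² ≤ (2−u)(1+u)²`. [cite: Booker2006, Lemma 4.4 (proof:
"on the real axis … verify the inequality using calculus")] -/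
theorem bookerE_deriv_nonpos {u : ℝ} (hu0 : 0 ≤ u) (hu1 : u < 1) :
    Real.log (2 + u) - Real.log (2 - u) - 2 * Real.log (1 + u) + 2 * Real.log (1 - u) ≤ 0 := by
  have hA : 0 < (2 + u) * (1 - u) ^ 2 := by
    have : 0 < 1 - u := by linarith
    positivity
  have hle : (2 + u) * (1 - u) ^ 2 ≤ (2 - u) * (1 + u) ^ 2 := by
    have h3 : 0 ≤ 3 - u ^ 2 := by nlinarith
    nlinarith [mul_nonneg hu0 h3]
  have hlog := Real.log_le_log hA hle
  rw [Real.log_mul (by linarith) (by positivity), Real.log_mul (by linarith) (by positivity),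
    Real.log_pow, Real.log_pow] at hlog
  push_cast at hlog
  linarith

/-- **Real-axis case** of Booker's inequality: `E(u) ≤ E(0) = 4 log 2` for `|u| < 1`.
[cite: Booker2006, Lemma 4.4 (proof)] -/
theorem bookerE_le {u : ℝ} (hu : |u| < 1) : bookerE u ≤ 4 * Real.log 2 := by
  have hE0 : bookerE 0 = 4 * Real.log 2 := by
    simp [bookerE]; ring
  -- `E` is antitone on `[0, 1)`
  have hanti : AntitoneOn bookerE (Set.Ico 0 1) := by
    refine antitoneOn_of_hasDerivWithinAt_nonpos (convex_Ico 0 1)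
      (f' := fun u => Real.log (2 + u) - Real.log (2 - u) - 2 * Real.log (1 + u)
        + 2 * Real.log (1 - u)) ?_ ?_ ?_
    · intro x hx
      exact (hasDerivAt_bookerE (by linarith [hx.1]) hx.2).continuousAt.continuousWithinAt
    · intro x hx
      rw [interior_Ico] at hx
      exact (hasDerivAt_bookerE (by linarith [hx.1]) hx.2).hasDerivWithinAt
    · intro x hx
      rw [interior_Ico] at hx
      exact bookerE_deriv_nonpos hx.1.le hx.2
  rcases le_or_gt 0 u with h | h
  · have hu1 : u < 1 := (abs_lt.mp hu).2
    rw [← hE0]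
    exact hanti ⟨le_rfl, by norm_num⟩ ⟨h, hu1⟩ h
  · have hu1 : -u < 1 := by have := (abs_lt.mp hu).1; linarith
    rw [← hE0, ← bookerE_neg]
    exact hanti ⟨le_rfl, by norm_num⟩ ⟨by linarith, hu1⟩ (by linarith)

/-- `Re 𝓕(u) = E(u)` for real `u`. [folklore] -/
theorem bookerF_ofReal_re (u : ℝ) : (bookerF u).re = bookerE u := by
  have e : bookerF u = ((u + 2 : ℝ) : ℂ) * log ((u + 2 : ℝ) : ℂ)
      - ((u - 2 : ℝ) : ℂ) * log ((u - 2 : ℝ) : ℂ) - 2 * (((u + 1 : ℝ) : ℂ) * log ((u + 1 : ℝ) : ℂ))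
      + 2 * (((u - 1 : ℝ) : ℂ) * log ((u - 1 : ℝ) : ℂ)) := by
    simp only [bookerF]; push_cast; ring_nf
  rw [e]
  simp only [Complex.sub_re, Complex.add_re, Complex.mul_re, Complex.ofReal_re, Complex.ofReal_im,
    Complex.log_ofReal_re, zero_mul, sub_zero, Complex.re_ofNat, Complex.im_ofNat]
  rw [show u - 2 = -(2 - u) by ring, show u - 1 = -(1 - u) by ring, Real.log_neg_eq_log,
    Real.log_neg_eq_log, bookerE]
  ring

/-- `Re g(u) = 1/(1+u) + 1/(1−u)` for real `u`. [folklore] -/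
theorem bookerG_ofReal_re (u : ℝ) : (bookerG u).re = 1 / (1 + u) + 1 / (1 - u) := by
  have e : bookerG u = ((1 / (1 + u) + 1 / (1 - u) : ℝ) : ℂ) := by
    simp only [bookerG]; push_cast; ring
  rw [e, Complex.ofReal_re]

/-- `Re H = Re 𝓕 − log 4 · Re g`. [folklore] -/
theorem bookerH_re (z : ℂ) : (bookerH z).re = (bookerF z).re - Real.log 4 * (bookerG z).re := by
  simp only [bookerH, Complex.sub_re, Complex.re_ofReal_mul]

/-- **Bottom edge**: `Re H(u) ≤ 0` for real `u` with `|u| < 1`.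
[cite: Booker2006, Lemma 4.4 (proof)] -/
theorem bookerH_ofReal_re_nonpos {u : ℝ} (hu : |u| < 1) : (bookerH u).re ≤ 0 := by
  rw [bookerH_re, bookerF_ofReal_re, bookerG_ofReal_re]
  have h1 : 0 < 1 + u := by have := (abs_lt.mp hu).1; linarith
  have h2 : 0 < 1 - u := by have := (abs_lt.mp hu).2; linarith
  have hG : 2 ≤ 1 / (1 + u) + 1 / (1 - u) := by
    rw [div_add_div _ _ h1.ne' h2.ne', le_div_iff₀ (mul_pos h1 h2)]
    nlinarith [sq_nonneg u]
  have hE := bookerE_le hu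
  have h4 := Real.log_four_eq
  nlinarith [real_log_four_pos]

/-! ### Pointwise form of the integrand off the real axis -/

/-- For `z = u + iv`, `v ≠ 0`, Booker's integrand (with `d = 1`) is
`ℓ(x+1+u) + ℓ(x+1−u) − ℓ(x+u) − ℓ(x−u)` with `ℓ(s) = ½ log(s² + v²)`. [folklore] -/
theorem bookerIntegrand_one_add_mul_I {v : ℝ} (hv : v ≠ 0) (u x : ℝ) :
    bookerIntegrand 1 (u + v * I) x =
      Real.log ((x + 1 + u) ^ 2 + v ^ 2) / 2 + Real.log ((x + 1 - u) ^ 2 + v ^ 2) / 2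
        - Real.log ((x + u) ^ 2 + v ^ 2) / 2 - Real.log ((x - u) ^ 2 + v ^ 2) / 2 := by
  have e1 : (x : ℂ) + 1 + (u + v * I) = ((x + 1 + u : ℝ) : ℂ) + v * I := by push_cast; ring
  have e2 : (x : ℂ) + 1 - conj ((u : ℂ) + v * I) = ((x + 1 - u : ℝ) : ℂ) + v * I := by
    simp only [map_add, map_mul, Complex.conj_ofReal, Complex.conj_I]; push_cast; ring
  have e3 : (x : ℂ) + (u + v * I) = ((x + u : ℝ) : ℂ) + v * I := by push_cast; ring
  have e4 : (x : ℂ) - conj ((u : ℂ) + v * I) = ((x - u : ℝ) : ℂ) + v * I := by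
    simp only [map_add, map_mul, Complex.conj_ofReal, Complex.conj_I]; push_cast; ring
  have hv2 : 0 < v ^ 2 := sq_pos_iff.mpr hv
  have hne : ∀ a : ℝ, ‖(a : ℂ) + v * I‖ ≠ 0 := fun a => by
    rw [Complex.norm_add_mul_I]; positivity
  -- `log |a + iv| = ½ log(a² + v²)` (cf. `Literature.Analysis.SpecialFunctions.GammaRatio.log_norm_eq`)
  have log_norm_ofReal_add_mul_I : ∀ a : ℝ,
      Real.log ‖(a : ℂ) + v * I‖ = Real.log (a ^ 2 + v ^ 2) / 2 := fun a => by
    rw [Complex.norm_add_mul_I, Real.log_sqrt (by positivity)]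
  simp only [bookerIntegrand, Complex.ofReal_one]
  rw [e1, e2, e3, e4, norm_div, norm_mul, norm_mul,
    Real.log_div (mul_ne_zero (hne _) (hne _)) (mul_ne_zero (hne _) (hne _)),
    Real.log_mul (hne _) (hne _), Real.log_mul (hne _) (hne _),
    log_norm_ofReal_add_mul_I, log_norm_ofReal_add_mul_I, log_norm_ofReal_add_mul_I,
    log_norm_ofReal_add_mul_I]
  ring

/-- `ℓ' = K`: the derivative of `s ↦ ½ log(s² + v²)` is `s/(s² + v²)` (`v ≠ 0`). [folklore] -/
theorem hasDerivAt_halfLogSq {v : ℝ} (hv : v ≠ 0) (s : ℝ) :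
    HasDerivAt (fun s : ℝ => Real.log (s ^ 2 + v ^ 2) / 2) (s / (s ^ 2 + v ^ 2)) s := by
  have hv2 : 0 < v ^ 2 := sq_pos_iff.mpr hv
  have hpos : 0 < s ^ 2 + v ^ 2 := by positivity
  have h1 : HasDerivAt (fun s : ℝ => s ^ 2 + v ^ 2) (2 * s) s := by
    simpa using (hasDerivAt_pow 2 s).add_const (v ^ 2)
  have h2 := (h1.log hpos.ne').div_const 2
  have e : 2 * s / (s ^ 2 + v ^ 2) / 2 = s / (s ^ 2 + v ^ 2) := by ring
  rw [e] at h2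
  exact h2

/-- Continuity of `s ↦ ½ log((s + c)² + v²)` (`v ≠ 0`). [folklore] -/
theorem continuous_halfLogSq_comp {v : ℝ} (hv : v ≠ 0) (c : ℝ) :
    Continuous fun s : ℝ => Real.log ((s + c) ^ 2 + v ^ 2) / 2 := by
  have hv2 : 0 < v ^ 2 := sq_pos_iff.mpr hv
  refine Continuous.div_const (Continuous.log (by fun_prop) fun s => ?_) 2
  positivity

/-! ### The vertical sides `Re z = ±1` -/

/-- On the sides, `Re 𝓕(±1 + iv) = ∫_0^1 (ℓ(x+2) − ℓ(x+1)) dx` (the remaining part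
`∫_0^1 (ℓ(x) − ℓ(x−1)) dx` vanishes by the reflection `x ↦ 1 − x`). [folklore] -/
theorem bookerF_side_re {v : ℝ} (hv : 0 < v) (σ : ℝ) (hσ : σ = 1 ∨ σ = -1) :
    (bookerF (σ + v * I)).re =
      ∫ x in (0:ℝ)..1, (Real.log ((x + 2) ^ 2 + v ^ 2) / 2 - Real.log ((x + 1) ^ 2 + v ^ 2) / 2) := by
  have hv0 : v ≠ 0 := hv.ne'
  have him : ((σ : ℂ) + v * I).im ≠ 0 := by simpa using hv0
  rw [← integral_bookerIntegrand_one_of_im_ne_zero him]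
  have hpt : ∀ x : ℝ, bookerIntegrand 1 (σ + v * I) x =
      (Real.log ((x + 2) ^ 2 + v ^ 2) / 2 - Real.log ((x + 1) ^ 2 + v ^ 2) / 2)
        + (Real.log ((x + 0) ^ 2 + v ^ 2) / 2 - Real.log ((1 - x + 0) ^ 2 + v ^ 2) / 2) := by
    intro x
    rw [bookerIntegrand_one_add_mul_I hv0]
    rcases hσ with h | h <;> subst h <;> ring_nf
  simp_rw [hpt]
  have i1 : IntervalIntegrable (fun x : ℝ =>
      Real.log ((x + 2) ^ 2 + v ^ 2) / 2 - Real.log ((x + 1) ^ 2 + v ^ 2) / 2) volume 0 1 :=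
    ((continuous_halfLogSq_comp hv0 2).sub (continuous_halfLogSq_comp hv0 1)).intervalIntegrable _ _
  have i2 : IntervalIntegrable (fun x : ℝ => Real.log ((x + 0) ^ 2 + v ^ 2) / 2) volume 0 1 :=
    (continuous_halfLogSq_comp hv0 0).intervalIntegrable _ _
  have i3 : IntervalIntegrable (fun x : ℝ => Real.log ((1 - x + 0) ^ 2 + v ^ 2) / 2) volume 0 1 := by
    refine Continuous.intervalIntegrable ?_ _ _
    have hv2 : 0 < v ^ 2 := sq_pos_iff.mpr hv0
    refine Continuous.div_const (Continuous.log (by fun_prop) fun s => ?_) 2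
    positivity
  have hcomp : ∫ x in (0:ℝ)..1, Real.log ((1 - x + 0) ^ 2 + v ^ 2) / 2
      = ∫ x in (0:ℝ)..1, Real.log ((x + 0) ^ 2 + v ^ 2) / 2 := by
    have h := intervalIntegral.integral_comp_sub_left
      (fun x : ℝ => Real.log ((x + 0) ^ 2 + v ^ 2) / 2) 1 (a := 0) (b := 1)
    norm_num at h ⊢
    exact h
  rw [intervalIntegral.integral_add i1 (i2.sub i3), intervalIntegral.integral_sub i2 i3, hcomp]
  ring

/-- `Re (a + ib)⁻¹ = a/(a² + b²)`. [folklore] -/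
theorem re_inv_ofReal_add_mul_I (a b : ℝ) : (((a : ℂ) + b * I)⁻¹).re = a / (a ^ 2 + b ^ 2) := by
  rw [Complex.inv_re, Complex.normSq_add_mul_I]
  simp

/-- `Re g(±1 + iv) = 2/(4 + v²)`. [folklore] -/
theorem bookerG_side_re (v : ℝ) (σ : ℝ) (hσ : σ = 1 ∨ σ = -1) :
    (bookerG (σ + v * I)).re = 2 / (4 + v ^ 2) := by
  rcases hσ with h | h <;> subst h
  · have e1 : (1 : ℂ) + (((1 : ℝ) : ℂ) + v * I) = ((2 : ℝ) : ℂ) + v * I := by push_cast; ring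
    have e2 : (1 : ℂ) - (((1 : ℝ) : ℂ) + v * I) = ((0 : ℝ) : ℂ) + ((-v : ℝ) : ℂ) * I := by
      push_cast; ring
    simp only [bookerG, one_div, Complex.add_re, e1, e2, re_inv_ofReal_add_mul_I]
    norm_num
  · have e1 : (1 : ℂ) + (((-1 : ℝ) : ℂ) + v * I) = ((0 : ℝ) : ℂ) + v * I := by push_cast; ring
    have e2 : (1 : ℂ) - (((-1 : ℝ) : ℂ) + v * I) = ((2 : ℝ) : ℂ) + ((-v : ℝ) : ℂ) * I := by
      push_cast; ring
    simp only [bookerG, one_div, Complex.add_re, e1, e2, re_inv_ofReal_add_mul_I]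
    norm_num

/-- Case `3v² ≥ 4` of the side estimate: pairing `s ↔ 4 − s`,
`K(s) + K(4−s) ≤ 2K(2)` on `[1,3]` (`K(s) = s/(s²+v²)`), hence
`∫_0^1 (ℓ(x+2) − ℓ(x+1)) dx ≤ 2/(4+v²)`. [folklore] -/
theorem side_integral_le_of_large {v : ℝ} (hv : 0 < v) (hv2 : 4 ≤ 3 * v ^ 2) :
    ∫ x in (0:ℝ)..1, (Real.log ((x + 2) ^ 2 + v ^ 2) / 2 - Real.log ((x + 1) ^ 2 + v ^ 2) / 2)
      ≤ 2 / (4 + v ^ 2) := by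
  have hv0 : v ≠ 0 := hv.ne'
  have h4v : 0 < 4 + v ^ 2 := by positivity
  -- `G(s) = ℓ(s) − ℓ(4−s) − c·s`, `c = 4/(4+v²)`, is antitone on `[1, 3]`
  have hGd : ∀ s : ℝ, HasDerivAt
      (fun s => Real.log (s ^ 2 + v ^ 2) / 2 - Real.log ((4 - s) ^ 2 + v ^ 2) / 2
        - 4 / (4 + v ^ 2) * s)
      (s / (s ^ 2 + v ^ 2) + (4 - s) / ((4 - s) ^ 2 + v ^ 2) - 4 / (4 + v ^ 2)) s := by
    intro s
    have h1 := hasDerivAt_halfLogSq hv0 s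
    have h2 := HasDerivAt.comp_const_sub 4 s (hasDerivAt_halfLogSq hv0 (4 - s))
    have h3 := (hasDerivAt_id' s).const_mul (4 / (4 + v ^ 2))
    exact ((h1.fun_sub h2).fun_sub h3).congr_deriv (by ring)
  have hGd_nonpos : ∀ s ∈ Set.Icc (1:ℝ) 3,
      s / (s ^ 2 + v ^ 2) + (4 - s) / ((4 - s) ^ 2 + v ^ 2) - 4 / (4 + v ^ 2) ≤ 0 := by
    intro s hs
    have hA : 0 < s ^ 2 + v ^ 2 := by positivity
    have hB : 0 < (4 - s) ^ 2 + v ^ 2 := by positivity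
    have key : 4 / (4 + v ^ 2) - (s / (s ^ 2 + v ^ 2) + (4 - s) / ((4 - s) ^ 2 + v ^ 2))
        = 4 * (s - 2) ^ 2 * (3 * v ^ 2 + (s - 2) ^ 2 - 4)
          / ((4 + v ^ 2) * (s ^ 2 + v ^ 2) * ((4 - s) ^ 2 + v ^ 2)) := by
      field_simp
      ring
    have hnum : 0 ≤ 4 * (s - 2) ^ 2 * (3 * v ^ 2 + (s - 2) ^ 2 - 4) := by
      have : 0 ≤ 3 * v ^ 2 + (s - 2) ^ 2 - 4 := by nlinarith
      positivity
    have : 0 ≤ 4 / (4 + v ^ 2) - (s / (s ^ 2 + v ^ 2) + (4 - s) / ((4 - s) ^ 2 + v ^ 2)) := by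
      rw [key]; positivity
    linarith
  have hanti : AntitoneOn
      (fun s => Real.log (s ^ 2 + v ^ 2) / 2 - Real.log ((4 - s) ^ 2 + v ^ 2) / 2
        - 4 / (4 + v ^ 2) * s) (Set.Icc 1 3) := by
    refine antitoneOn_of_hasDerivWithinAt_nonpos (convex_Icc 1 3)
      (fun s _ => (hGd s).continuousAt.continuousWithinAt)
      (fun s _ => (hGd s).hasDerivWithinAt) ?_
    intro s hs
    rw [interior_Icc] at hs
    exact hGd_nonpos s ⟨hs.1.le, hs.2.le⟩
  -- pointwise bound for the symmetrised integrand
  have hpt : ∀ x ∈ Set.Icc (0:ℝ) 1,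
      (Real.log ((x + 2) ^ 2 + v ^ 2) / 2 - Real.log ((x + 1) ^ 2 + v ^ 2) / 2)
        + (Real.log ((1 - x + 2) ^ 2 + v ^ 2) / 2 - Real.log ((1 - x + 1) ^ 2 + v ^ 2) / 2)
        ≤ 4 / (4 + v ^ 2) := by
    intro x hx
    have h : Real.log ((x + 2) ^ 2 + v ^ 2) / 2 - Real.log ((4 - (x + 2)) ^ 2 + v ^ 2) / 2
          - 4 / (4 + v ^ 2) * (x + 2)
        ≤ Real.log ((x + 1) ^ 2 + v ^ 2) / 2 - Real.log ((4 - (x + 1)) ^ 2 + v ^ 2) / 2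
          - 4 / (4 + v ^ 2) * (x + 1) :=
      hanti ⟨by linarith [hx.1], by linarith [hx.2]⟩ ⟨by linarith [hx.1], by linarith [hx.2]⟩
        (show x + 1 ≤ x + 2 by linarith)
    have e1 : (4 - (x + 2)) ^ 2 = (1 - x + 1) ^ 2 := by ring
    have e2 : (4 - (x + 1)) ^ 2 = (1 - x + 2) ^ 2 := by ring
    rw [e1, e2] at h
    linarith
  -- integrate
  have hc1 := continuous_halfLogSq_comp hv0 1
  have hc2 := continuous_halfLogSq_comp hv0 2
  have hrefl : Continuous fun x : ℝ => 1 - x := continuous_const.sub continuous_id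
  have i1 : IntervalIntegrable (fun x : ℝ =>
      Real.log ((x + 2) ^ 2 + v ^ 2) / 2 - Real.log ((x + 1) ^ 2 + v ^ 2) / 2) volume 0 1 :=
    (hc2.sub hc1).intervalIntegrable _ _
  have i2 : IntervalIntegrable (fun x : ℝ =>
      Real.log ((1 - x + 2) ^ 2 + v ^ 2) / 2 - Real.log ((1 - x + 1) ^ 2 + v ^ 2) / 2) volume 0 1 :=
    ((hc2.comp hrefl).sub (hc1.comp hrefl)).intervalIntegrable _ _
  have hsymm : ∫ x in (0:ℝ)..1,
      (Real.log ((1 - x + 2) ^ 2 + v ^ 2) / 2 - Real.log ((1 - x + 1) ^ 2 + v ^ 2) / 2)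
      = ∫ x in (0:ℝ)..1, (Real.log ((x + 2) ^ 2 + v ^ 2) / 2 - Real.log ((x + 1) ^ 2 + v ^ 2) / 2) := by
    have h := intervalIntegral.integral_comp_sub_left
      (fun x : ℝ => Real.log ((x + 2) ^ 2 + v ^ 2) / 2 - Real.log ((x + 1) ^ 2 + v ^ 2) / 2) 1
      (a := 0) (b := 1)
    simpa using h
  have hle := intervalIntegral.integral_mono_on zero_le_one (i1.add i2) (by simp) hpt
  rw [intervalIntegral.integral_add i1 i2, hsymm, intervalIntegral.integral_const] at hle
  simp only [sub_zero, smul_eq_mul, one_mul] at hle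
  have e : (2 : ℝ) / (4 + v ^ 2) = 4 / (4 + v ^ 2) / 2 := by ring
  rw [e]
  linarith

/-- For every `v > 0`: `∫_0^1 (ℓ(x+2) − ℓ(x+1)) dx ≤ 1/(2v)` (since `K(s) ≤ 1/(2v)`). [folklore] -/
theorem side_integral_le_inv {v : ℝ} (hv : 0 < v) :
    ∫ x in (0:ℝ)..1, (Real.log ((x + 2) ^ 2 + v ^ 2) / 2 - Real.log ((x + 1) ^ 2 + v ^ 2) / 2)
      ≤ 1 / (2 * v) := by
  have hv0 : v ≠ 0 := hv.ne'
  have hGd : ∀ s : ℝ, HasDerivAt (fun s => Real.log (s ^ 2 + v ^ 2) / 2 - s / (2 * v))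
      (s / (s ^ 2 + v ^ 2) - 1 / (2 * v)) s := fun s =>
    (hasDerivAt_halfLogSq hv0 s).fun_sub ((hasDerivAt_id' s).div_const (2 * v))
  have hanti : Antitone (fun s => Real.log (s ^ 2 + v ^ 2) / 2 - s / (2 * v)) := by
    refine antitone_of_hasDerivAt_nonpos hGd fun s => ?_
    show s / (s ^ 2 + v ^ 2) - 1 / (2 * v) ≤ 0
    have hA : 0 < s ^ 2 + v ^ 2 := by positivity
    have key : 1 / (2 * v) - s / (s ^ 2 + v ^ 2) = (s - v) ^ 2 / (2 * v * (s ^ 2 + v ^ 2)) := by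
      field_simp; ring
    have : 0 ≤ 1 / (2 * v) - s / (s ^ 2 + v ^ 2) := by rw [key]; positivity
    linarith
  have hpt : ∀ x ∈ Set.Icc (0:ℝ) 1,
      Real.log ((x + 2) ^ 2 + v ^ 2) / 2 - Real.log ((x + 1) ^ 2 + v ^ 2) / 2 ≤ 1 / (2 * v) := by
    intro x _
    have h : Real.log ((x + 2) ^ 2 + v ^ 2) / 2 - (x + 2) / (2 * v)
        ≤ Real.log ((x + 1) ^ 2 + v ^ 2) / 2 - (x + 1) / (2 * v) :=
      hanti (show x + 1 ≤ x + 2 by linarith)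
    have : (x + 2) / (2 * v) - (x + 1) / (2 * v) = 1 / (2 * v) := by field_simp; ring
    linarith
  have i1 : IntervalIntegrable (fun x : ℝ =>
      Real.log ((x + 2) ^ 2 + v ^ 2) / 2 - Real.log ((x + 1) ^ 2 + v ^ 2) / 2) volume 0 1 :=
    ((continuous_halfLogSq_comp hv0 2).sub (continuous_halfLogSq_comp hv0 1)).intervalIntegrable _ _
  have hle := intervalIntegral.integral_mono_on zero_le_one i1 (by simp) hpt
  simpa using hle

/-- For every `v ≠ 0`: `∫_0^1 (ℓ(x+2) − ℓ(x+1)) dx ≤ 3 log 3 − 4 log 2`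
(since `ℓ(x+2) − ℓ(x+1) ≤ log(x+2) − log(x+1)` on `[0,1]`). [folklore] -/
theorem side_integral_le_log {v : ℝ} (hv : 0 < v) :
    ∫ x in (0:ℝ)..1, (Real.log ((x + 2) ^ 2 + v ^ 2) / 2 - Real.log ((x + 1) ^ 2 + v ^ 2) / 2)
      ≤ 3 * Real.log 3 - 4 * Real.log 2 := by
  have hv0 : v ≠ 0 := hv.ne'
  have hpt : ∀ x ∈ Set.Icc (0:ℝ) 1,
      Real.log ((x + 2) ^ 2 + v ^ 2) / 2 - Real.log ((x + 1) ^ 2 + v ^ 2) / 2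
        ≤ Real.log (x + 2) - Real.log (x + 1) := by
    intro x hx
    have hx0 : 0 ≤ x := hx.1
    have h1 : 0 < x + 1 := by linarith
    have h2 : 0 < x + 2 := by linarith
    have hA : 0 < (x + 2) ^ 2 + v ^ 2 := by positivity
    have hB : 0 < (x + 1) ^ 2 + v ^ 2 := by positivity
    have hle : ((x + 2) ^ 2 + v ^ 2) * (x + 1) ^ 2 ≤ ((x + 1) ^ 2 + v ^ 2) * (x + 2) ^ 2 := by
      nlinarith [sq_nonneg v]
    have hlog := Real.log_le_log (by positivity) hle
    rw [Real.log_mul hA.ne' (by positivity), Real.log_mul hB.ne' (by positivity), Real.log_pow,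
      Real.log_pow] at hlog
    push_cast at hlog
    linarith
  have i1 : IntervalIntegrable (fun x : ℝ =>
      Real.log ((x + 2) ^ 2 + v ^ 2) / 2 - Real.log ((x + 1) ^ 2 + v ^ 2) / 2) volume 0 1 :=
    ((continuous_halfLogSq_comp hv0 2).sub (continuous_halfLogSq_comp hv0 1)).intervalIntegrable _ _
  have hint : ∀ c : ℝ, IntervalIntegrable (fun x : ℝ => Real.log (x + c)) volume 0 1 := by
    intro c
    have h := (intervalIntegral.intervalIntegrable_log' (a := 0 + c) (b := 1 + c)).comp_add_right c
    simpa using h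
  have hle := intervalIntegral.integral_mono_on zero_le_one i1 ((hint 2).sub (hint 1)) hpt
  rw [intervalIntegral.integral_sub (hint 2) (hint 1), integral_real_log_add,
    integral_real_log_add] at hle
  norm_num at hle
  linarith

/-- **The side estimate**: for `v > 0`,
`∫_0^1 (ℓ(x+2) − ℓ(x+1)) dx ≤ log 4 · 2/(4+v²)` (three ranges of `v`).
[cite: Booker2006, Lemma 4.4 (proof: the case `Re w = ½`, there verified numerically)] -/
theorem side_integral_le {v : ℝ} (hv : 0 < v) :
    ∫ x in (0:ℝ)..1, (Real.log ((x + 2) ^ 2 + v ^ 2) / 2 - Real.log ((x + 1) ^ 2 + v ^ 2) / 2)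
      ≤ Real.log 4 * (2 / (4 + v ^ 2)) := by
  have hl4 := real_log_four_gt
  have h4v : 0 < 4 + v ^ 2 := by positivity
  rcases le_or_gt v 1 with h1 | h1
  · -- `v ≤ 1`: `3 log 3 − 4 log 2 ≤ (4/5) log 2 ≤ log 4 · 2/(4+v²)`
    refine (side_integral_le_log hv).trans ?_
    have hlog3 := Real.log_three_lt_d9
    have hlog2 := Real.log_two_gt_d9
    have h5 : 2 * Real.log 2 * (2 / 5) ≤ 2 * Real.log 2 * (2 / (4 + v ^ 2)) := by
      have hv1 : v ^ 2 ≤ 1 := by nlinarith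
      apply mul_le_mul_of_nonneg_left _ (by linarith)
      rw [div_le_div_iff₀ (by norm_num) h4v]
      nlinarith
    rw [Real.log_four_eq]
    linarith
  rcases le_or_gt (3 * v ^ 2) 4 with h2 | h2
  · -- `1 < v`, `3v² ≤ 4`: `1/(2v) ≤ log 4 · 2/(4+v²)` since `4 + v² ≤ 4 v log 4`
    refine (side_integral_le_inv hv).trans ?_
    have key : 4 + v ^ 2 ≤ 4 * v * Real.log 4 := by
      nlinarith [mul_pos (sub_pos.mpr h1) (sub_pos.mpr hl4)]
    have e : Real.log 4 * (2 / (4 + v ^ 2)) = (4 * v * Real.log 4) / (4 + v ^ 2) / (2 * v) := by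
      field_simp
      norm_num
    rw [e, div_le_div_iff_of_pos_right (by positivity : (0:ℝ) < 2 * v), le_div_iff₀ h4v, one_mul]
    exact key
  · -- `3v² > 4`: `2/(4+v²) ≤ log 4 · 2/(4+v²)`
    refine (side_integral_le_of_large hv h2.le).trans ?_
    have : 0 < 2 / (4 + v ^ 2) := by positivity
    nlinarith

/-- **Vertical sides**: `Re H(±1 + iv) ≤ 0` for `v > 0`.
[cite: Booker2006, Lemma 4.4 (proof)] -/
theorem bookerH_side_re_nonpos {v : ℝ} (hv : 0 < v) (σ : ℝ) (hσ : σ = 1 ∨ σ = -1) :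
    (bookerH (σ + v * I)).re ≤ 0 := by
  rw [bookerH_re, bookerF_side_re hv σ hσ, bookerG_side_re v σ hσ]
  have := side_integral_le hv
  linarith

/-! ### The top edge -/

/-- `Re g(u + iT) ≥ 0` for `|u| ≤ 1`. [folklore] -/
theorem bookerG_re_nonneg {u T : ℝ} (hu : |u| ≤ 1) : 0 ≤ (bookerG (u + T * I)).re := by
  have h1 : 0 ≤ 1 + u := by have := (abs_le.mp hu).1; linarith
  have h2 : 0 ≤ 1 - u := by have := (abs_le.mp hu).2; linarith
  have e1 : (1 : ℂ) + (u + T * I) = ((1 + u : ℝ) : ℂ) + T * I := by push_cast; ring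
  have e2 : (1 : ℂ) - (u + T * I) = ((1 - u : ℝ) : ℂ) + ((-T : ℝ) : ℂ) * I := by push_cast; ring
  simp only [bookerG, one_div, Complex.add_re, e1, e2, re_inv_ofReal_add_mul_I]
  exact add_nonneg (div_nonneg h1 (by positivity)) (div_nonneg h2 (by positivity))

/-- **Top edge**: `Re H(u + iT) ≤ 5/T²` for `|u| ≤ 1`, `T > 0` (crude decay `log(1+y) ≤ y`).
[cite: Booker2006, Lemma 4.4 (proof: "f and g are each asymptotic to −2/w²")] -/
theorem bookerH_top_re_le {u T : ℝ} (hu : |u| ≤ 1) (hT : 0 < T) :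
    (bookerH (u + T * I)).re ≤ 5 / T ^ 2 := by
  have hT0 : T ≠ 0 := hT.ne'
  have hT2 : 0 < T ^ 2 := by positivity
  have him : ((u : ℂ) + T * I).im ≠ 0 := by simpa using hT0
  rw [bookerH_re]
  have hG := bookerG_re_nonneg (T := T) hu
  have hF : (bookerF (u + T * I)).re ≤ 5 / T ^ 2 := by
    rw [← integral_bookerIntegrand_one_of_im_ne_zero him]
    -- pointwise bound of the integrand
    have hstep : ∀ s : ℝ, -1 ≤ s → s ≤ 2 →
        Real.log ((s + 1) ^ 2 + T ^ 2) / 2 - Real.log (s ^ 2 + T ^ 2) / 2 ≤ 5 / (2 * T ^ 2) := by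
      intro s hs1 hs2
      have hA : 0 < s ^ 2 + T ^ 2 := by positivity
      have hB : 0 < (s + 1) ^ 2 + T ^ 2 := by positivity
      have h := Real.log_le_sub_one_of_pos (div_pos hB hA)
      rw [Real.log_div hB.ne' hA.ne'] at h
      have h2 : ((s + 1) ^ 2 + T ^ 2) / (s ^ 2 + T ^ 2) - 1 = (2 * s + 1) / (s ^ 2 + T ^ 2) := by
        field_simp; ring
      have h3 : (2 * s + 1) / (s ^ 2 + T ^ 2) ≤ 5 / T ^ 2 := by
        rw [div_le_div_iff₀ hA hT2]; nlinarith [sq_nonneg s]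
      have e5 : (5 : ℝ) / (2 * T ^ 2) = 5 / T ^ 2 / 2 := by rw [div_div, mul_comm]
      rw [e5]
      linarith
    have hpt : ∀ x ∈ Set.Icc (0:ℝ) 1, bookerIntegrand 1 (u + T * I) x ≤ 5 / T ^ 2 := by
      intro x hx
      rw [bookerIntegrand_one_add_mul_I hT0]
      have hu1 := (abs_le.mp hu).1
      have hu2 := (abs_le.mp hu).2
      have ha := hstep (x + u) (by linarith [hx.1]) (by linarith [hx.2])
      have hb := hstep (x - u) (by linarith [hx.1]) (by linarith [hx.2])
      have e1 : (x + u + 1) ^ 2 = (x + 1 + u) ^ 2 := by ring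
      have e2 : (x - u + 1) ^ 2 = (x + 1 - u) ^ 2 := by ring
      rw [e1] at ha; rw [e2] at hb
      have : 5 / (2 * T ^ 2) + 5 / (2 * T ^ 2) = 5 / T ^ 2 := by field_simp; ring
      linarith
    by_cases hI : IntervalIntegrable (fun x => bookerIntegrand 1 (u + T * I) x) volume 0 1
    · have hle := intervalIntegral.integral_mono_on zero_le_one hI (by simp) hpt
      simpa using hle
    · rw [intervalIntegral.integral_undef hI]; positivity
  nlinarith [real_log_four_pos]

end Literature.NumberTheory.LFunctions
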